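import Literature.NumberTheory.QuadraticFields.ReducedQuadraticIrrationalsModules
import Mathlib.Algebra.Algebra.Operations
import Mathlib.Data.Nat.Prime.Int
import Mathlib.Data.Int.GCD
import HarnessLib

/-!
# Duplication (squaring) of a quadratic irrational's module: the giant step `I ↦ I·I`

Topic `NumberTheory/QuadraticFields`; continues `ReducedQuadraticIrrationalsModules.lean`.
Theorem-and-definition file (no named facts). For an *ideal-shaped* quotient `x = (b, 2a)`
(`a > 0`, `4a ∣ b² − D`; the form `(a, b, c)`, `c = (b² − D)/4a`, primitive) the lattice
`L(x) = 2aℤ + (b + √D)ℤ = 2·(aℤ + ((b + √D)/2)ℤ)` is twice Jozsa's ideal `I` (Jozsa 2003, §5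
Prop. 16), and **the square of the ideal is computed by Dirichlet–Gauss duplication**
(Jozsa 2003, §7.1, the special case `I₁ = I₂ = I` of Prop. 34 with `k' = gcd(a, b) = ua + wb`,
`a' = a²/k'²`, `b' = (uab + w(b² + D)/2)/k'`; Buell 1989, §4.2, duplication):

* `fa x = a`, `fc x = c`, `IsIdealShaped`, `IsPrimitive` (`gcd(a, b, c) = 1`), `latZ x = L(x)`
  (a `ℤ`-submodule of `ℝ`, `mem_latZ_iff`);
* `dup x = (b − 2w(a/g)c, 2(a/g)²)` with `g = gcd(a, b) = ua + wb`, and the verified identities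
  `b'² − D = 4a'c'`, `c' = c(gu + w²c)` (`isIdealShaped_dup`), `isPrimitive_dup`;
* **`latZ_mul_latZ : L(x)·L(x) = span{2g·Q', 2g(b' + √D)} = 2g · L(dup x)`** — the module
  identity `I² = (g/a')·(a'ℤ + ((b' + √D)/2)ℤ)` of Jozsa's Prop. 34, proved by explicit
  generator bookkeeping (`2g(b' + √D) = u·2a(b + √D) + w(b + √D)²`, …), and its reading in the
  normalisation `J = L/Q`: `J(x)² = (1/g)·J(dup x)` (`mem_jmod_sq`).

## References

* R. Jozsa, arXiv:quant-ph/0302134 (2003), §5 Prop. 16, §7.1 Prop. 34 and the display after it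
  (`I₂ = I·I`, `k' = gcd(a, b)`, `a' = a²/k'²`, `δ(I₂) = 2δ(I)`). [Jozsa2003]
* D. A. Buell, *Binary Quadratic Forms*, Springer (1989), §4.2 (composition and duplication
  algorithms). [Buell1989]
-/

noncomputable section

open scoped Classical Pointwise

namespace Literature.NumberTheory.QuadraticFields

namespace QuadIrr

variable {D : ℕ}

/-! ### Form data of an ideal-shaped quotient -/

/-- `a = Q/2`. [cite: Jozsa2003, §5 Prop. 16 (I = k(aℤ + (b+√D)/2 ℤ))] -/
def fa (x : QuadIrr D) : ℤ := x.Q / 2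

/-- `c = (b² − D)/(4a) = (P² − D)/(2Q)`. [cite: Jozsa2003, §6.2 (c = |D − b²|/4a)] -/
def fc (x : QuadIrr D) : ℤ := (x.P ^ 2 - D) / (2 * x.Q)

/-- Ideal-shaped data: `Q > 0` even and `2Q ∣ P² − D` (i.e. `a > 0`, `4a ∣ b² − D`).
[cite: Jozsa2003, §5 Prop. 16] -/
def IsIdealShaped (x : QuadIrr D) : Prop := 0 < x.Q ∧ 2 ∣ x.Q ∧ 2 * x.Q ∣ x.P ^ 2 - D

/-- Primitive form: `gcd(a, b, c) = 1`. [cite: Buell1989, §4.2 (primitive forms)] -/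
def IsPrimitive (x : QuadIrr D) : Prop := Int.gcd (Int.gcd (fa x) x.P) (fc x) = 1

/-- `Q = 2a`. [cite: Jozsa2003, §5 Prop. 16] -/
theorem Q_eq_two_mul_fa {x : QuadIrr D} (h : x.IsIdealShaped) : x.Q = 2 * fa x := by
  unfold fa; obtain ⟨k, hk⟩ := h.2.1; omega

/-- `b² − D = 4ac`. [cite: Jozsa2003, §6.2 (c = (b² − D)/4a)] -/
theorem sq_sub_eq {x : QuadIrr D} (h : x.IsIdealShaped) : x.P ^ 2 - D = 4 * fa x * fc x := by
  obtain ⟨k, hk⟩ := h.2.2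
  have hQ : x.Q ≠ 0 := h.1.ne'
  have hc : fc x = k := by
    unfold fc; rw [hk, mul_comm (2 * x.Q) k, Int.mul_ediv_cancel _ (by omega)]
  rw [hc, hk, Q_eq_two_mul_fa h]; ring

/-- Ideal-shaped data is admissible. [cite: Jozsa2003, §5 Prop. 16] -/
theorem IsIdealShaped.isAdmissible {x : QuadIrr D} (h : x.IsIdealShaped) : x.IsAdmissible := by
  refine ⟨h.1.ne', ?_⟩
  obtain ⟨k, hk⟩ := h.2.2
  exact ⟨-(2 * k), by linarith⟩

/-! ### The lattice `L(x) = Qℤ + (P + √D)ℤ` -/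

/-- `L(x) = Qℤ + (P + √D)ℤ ⊂ ℝ`, twice Jozsa's ideal `aℤ + ((b + √D)/2)ℤ`. [cite: Jozsa2003, §5 Prop. 16] -/
def latZ (x : QuadIrr D) : Submodule ℤ ℝ := Submodule.span ℤ {(x.Q : ℝ), (x.P : ℝ) + Real.sqrt D}

/-- Membership in `L(x)`. [cite: Jozsa2003, §5 Prop. 16] -/
theorem mem_latZ_iff {x : QuadIrr D} {t : ℝ} :
    t ∈ latZ x ↔ ∃ m n : ℤ, t = m * x.Q + n * (x.P + Real.sqrt D) := by
  unfold latZ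
  rw [Submodule.mem_span_pair]
  constructor
  · rintro ⟨m, n, h⟩; exact ⟨m, n, by rw [← h]; simp only [zsmul_eq_mul]⟩
  · rintro ⟨m, n, h⟩; exact ⟨m, n, by rw [h]; simp only [zsmul_eq_mul]⟩

/-- `L(x) = Q · J(x)`. [cite: Jozsa2003, §6.1 Prop. 18] -/
theorem mem_latZ_iff_mem_jmod {x : QuadIrr D} (hQ : x.Q ≠ 0) {t : ℝ} :
    t ∈ latZ x ↔ t / x.Q ∈ jmod x := by
  have hQ' : (x.Q : ℝ) ≠ 0 := by exact_mod_cast hQ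
  rw [mem_latZ_iff, mem_jmod_iff]
  unfold val
  constructor
  · rintro ⟨m, n, rfl⟩; exact ⟨m, n, by field_simp⟩
  · rintro ⟨m, n, h⟩; exact ⟨m, n, by field_simp at h; linarith⟩

/-! ### Duplication -/

/-- `g = gcd(a, b)`. [cite: Jozsa2003, §7.1 (k' = gcd(a, b))] -/
def dupG (x : QuadIrr D) : ℤ := Int.gcd (fa x) x.P
/-- `u` with `ua + wb = g`. [cite: Jozsa2003, §7.1 (k' = ua + wb)] -/
def dupU (x : QuadIrr D) : ℤ := Int.gcdA (fa x) x.P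
/-- `w` with `ua + wb = g`. [cite: Jozsa2003, §7.1 (k' = ua + wb)] -/
def dupW (x : QuadIrr D) : ℤ := Int.gcdB (fa x) x.P

/-- **Duplication**: `dup x = (b', 2a')` with `a' = (a/g)²`, `b' = b − 2w(a/g)c`
(`≡ (uab + w(b² + D)/2)/g (mod 2a')`). [cite: Jozsa2003, §7.1 (I₂ = I·I, a' = a²/k'², b')] -/
def dup (x : QuadIrr D) : QuadIrr D :=
  ⟨x.P - 2 * dupW x * (fa x / dupG x) * fc x, 2 * (fa x / dupG x) ^ 2⟩

/-- Bézout: `ua + wb = g`. [folklore] -/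
theorem dup_bezout (x : QuadIrr D) : dupU x * fa x + dupW x * x.P = dupG x := by
  unfold dupU dupW dupG; rw [Int.gcd_eq_gcd_ab]; ring

/-- `g > 0` for ideal-shaped data. [folklore] -/
theorem dupG_pos {x : QuadIrr D} (h : x.IsIdealShaped) : 0 < dupG x := by
  unfold dupG
  have ha : fa x ≠ 0 := by have := Q_eq_two_mul_fa h; have := h.1; omega
  exact_mod_cast Int.gcd_pos_of_ne_zero_left _ ha

/-- The data of the duplication identities. [cite: Jozsa2003, §7.1] -/
structure DupData (x : QuadIrr D) where
  /-- `a₁ = a/g` -/ a₁ : ℤ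
  /-- `b₁ = b/g` -/ b₁ : ℤ
  /-- Bézout for `gcd(g, c) = 1` -/ α : ℤ
  /-- Bézout for `gcd(g, c) = 1` -/ t : ℤ
  ha : fa x = dupG x * a₁
  hb : x.P = dupG x * b₁
  hαt : α * dupG x + t * fc x = 1

/-- Ideal-shaped primitive data admits duplication data. [cite: Jozsa2003, §7.1] -/
theorem exists_dupData {x : QuadIrr D} (hp : x.IsPrimitive) : Nonempty (DupData x) := by
  obtain ⟨a₁, ha⟩ := (Int.gcd_dvd_left (fa x) x.P : (dupG x : ℤ) ∣ fa x)
  obtain ⟨b₁, hb⟩ := (Int.gcd_dvd_right (fa x) x.P : (dupG x : ℤ) ∣ x.P)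
  have hg : Int.gcd (dupG x) (fc x) = 1 := hp
  refine ⟨⟨a₁, b₁, Int.gcdA (dupG x) (fc x), Int.gcdB (dupG x) (fc x), ha, hb, ?_⟩⟩
  have := Int.gcd_eq_gcd_ab (dupG x) (fc x)
  rw [hg] at this; push_cast at this; linarith

/-- `a₁ > 0`. [folklore] -/
theorem DupData.a₁_pos {x : QuadIrr D} (h : x.IsIdealShaped) (d : DupData x) : 0 < d.a₁ := by
  have h1 := Q_eq_two_mul_fa h
  have h2 := h.1
  have h3 := dupG_pos h
  have h4 := d.ha
  nlinarith

/-- `ua₁ + wb₁ = 1`. [folklore] -/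
theorem DupData.bezout₁ {x : QuadIrr D} (h : x.IsIdealShaped) (d : DupData x) :
    dupU x * d.a₁ + dupW x * d.b₁ = 1 := by
  have hbz := dup_bezout x
  rw [d.ha, d.hb] at hbz
  have hg := dupG_pos h
  have : dupG x * (dupU x * d.a₁ + dupW x * d.b₁) = dupG x * 1 := by linarith
  exact mul_left_cancel₀ hg.ne' this

/-- The coefficients of `dup x` in terms of the data. [cite: Jozsa2003, §7.1] -/
theorem dup_P_Q {x : QuadIrr D} (h : x.IsIdealShaped) (d : DupData x) :
    (dup x).P = x.P - 2 * dupW x * d.a₁ * fc x ∧ (dup x).Q = 2 * d.a₁ ^ 2 := by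
  have hg := dupG_pos h
  have ha1 : fa x / dupG x = d.a₁ := by rw [d.ha, mul_comm, Int.mul_ediv_cancel _ hg.ne']
  exact ⟨by simp [dup, ha1], by simp [dup, ha1]⟩

/-- **`b'² − D = 4a'c'` with `c' = c(gu + w²c)`; `dup x` is ideal-shaped.**
[cite: Jozsa2003, §7.1 (a' = a²/k'², 4a' ∣ b'² − D)] -/
theorem dup_sq_sub {x : QuadIrr D} (h : x.IsIdealShaped) (d : DupData x) :
    (dup x).P ^ 2 - D = 4 * d.a₁ ^ 2 * (fc x * (dupG x * dupU x + dupW x ^ 2 * fc x)) := by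
  obtain ⟨hP, -⟩ := dup_P_Q h d
  have h1 := sq_sub_eq h
  have h2 := dup_bezout x
  rw [hP]
  rw [d.ha] at h1 h2
  -- `b² − D = 4 g a₁ c`, `u g a₁ + w b = g`
  linear_combination h1 - (4 * d.a₁ * fc x) * h2

/-- `dup x` is ideal-shaped. [cite: Jozsa2003, §7.1] -/
theorem isIdealShaped_dup {x : QuadIrr D} (h : x.IsIdealShaped) (d : DupData x) : (dup x).IsIdealShaped := by
  obtain ⟨hP, hQ⟩ := dup_P_Q h d
  have ha := d.a₁_pos h
  refine ⟨by rw [hQ]; positivity, ⟨d.a₁ ^ 2, by rw [hQ]⟩, ?_⟩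
  rw [hQ, dup_sq_sub h d]
  exact ⟨fc x * (dupG x * dupU x + dupW x ^ 2 * fc x), by ring⟩

/-- `fa (dup x) = a₁²` and `fc (dup x) = c(gu + w²c)`. [cite: Jozsa2003, §7.1] -/
theorem fa_fc_dup {x : QuadIrr D} (h : x.IsIdealShaped) (d : DupData x) :
    fa (dup x) = d.a₁ ^ 2 ∧ fc (dup x) = fc x * (dupG x * dupU x + dupW x ^ 2 * fc x) := by
  obtain ⟨hP, hQ⟩ := dup_P_Q h d
  have ha := d.a₁_pos h
  constructor
  · unfold fa; rw [hQ]; simp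
  · unfold fc
    rw [dup_sq_sub h d, hQ, show 4 * d.a₁ ^ 2 * (fc x * (dupG x * dupU x + dupW x ^ 2 * fc x)) =
      (fc x * (dupG x * dupU x + dupW x ^ 2 * fc x)) * (2 * (2 * d.a₁ ^ 2)) by ring]
    exact Int.mul_ediv_cancel _ (by positivity)

/-- **Duplication preserves primitivity.** [cite: Buell1989, §4.2 (the composition of primitive forms is primitive)] -/
theorem isPrimitive_dup {x : QuadIrr D} (h : x.IsIdealShaped) (hp : x.IsPrimitive) (d : DupData x) :
    (dup x).IsPrimitive := by
  obtain ⟨hfa, hfc⟩ := fa_fc_dup h d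
  obtain ⟨hP, -⟩ := dup_P_Q h d
  unfold IsPrimitive
  rw [hfa, hfc, hP]
  by_contra hne
  obtain ⟨p, hp1, hpdvd⟩ := Nat.exists_prime_and_dvd hne
  have hpZ : Prime (p : ℤ) := Nat.prime_iff_prime_int.mp hp1
  set g := dupG x
  set u := dupU x
  set w := dupW x
  set c := fc x
  -- `p ∣ a₁²`, `p ∣ b'`, `p ∣ c'`
  have h3 : (p : ℤ) ∣ (Int.gcd (Int.gcd (d.a₁ ^ 2) (x.P - 2 * w * d.a₁ * c)) (c * (g * u + w ^ 2 * c)) : ℤ) :=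
    Int.natCast_dvd_natCast.mpr hpdvd
  have hpa2 : (p : ℤ) ∣ d.a₁ ^ 2 := h3.trans ((Int.gcd_dvd_left _ _).trans (Int.gcd_dvd_left _ _))
  have hpb' : (p : ℤ) ∣ x.P - 2 * w * d.a₁ * c := h3.trans ((Int.gcd_dvd_left _ _).trans (Int.gcd_dvd_right _ _))
  have hpc' : (p : ℤ) ∣ c * (g * u + w ^ 2 * c) := h3.trans (Int.gcd_dvd_right _ _)
  have hpa : (p : ℤ) ∣ d.a₁ := hpZ.dvd_of_dvd_pow hpa2
  have hpb : (p : ℤ) ∣ x.P := by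
    have : x.P = (x.P - 2 * w * d.a₁ * c) + 2 * w * c * d.a₁ := by ring
    rw [this]; exact dvd_add hpb' (hpa.mul_left _)
  -- `p ∣ g` since `gcd(a₁, b₁) = 1` forces `p ∤ b₁`
  have hbz := d.bezout₁ h
  have hpg : (p : ℤ) ∣ g := by
    rw [d.hb] at hpb
    rcases hpZ.dvd_or_dvd hpb with hg' | hb1
    · exact hg'
    · exfalso
      have : (p : ℤ) ∣ u * d.a₁ + w * d.b₁ := dvd_add (hpa.mul_left _) (hb1.mul_left _)
      rw [hbz] at this
      exact hpZ.not_dvd_one this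
  rcases hpZ.dvd_or_dvd hpc' with hpc | hpc2
  · -- `p ∣ a, b, c`: contradicts primitivity
    have hpfa : (p : ℤ) ∣ fa x := by rw [d.ha]; exact hpg.mul_right _
    have hg1 : Int.gcd (Int.gcd (fa x) x.P) c = 1 := hp
    have : (p : ℤ) ∣ (Int.gcd (Int.gcd (fa x) x.P) c : ℤ) :=
      Int.dvd_coe_gcd (Int.dvd_coe_gcd hpfa hpb) hpc
    rw [hg1] at this
    exact hpZ.not_dvd_one (by exact_mod_cast this)
  · -- `p ∣ gu + w²c` and `p ∣ g` give `p ∣ w` (as `p ∤ c`… or `p ∣ c` handled above); then `1 = ua₁ + wb₁ ≡ 0`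
    have hw2c : (p : ℤ) ∣ w ^ 2 * c := by
      have : w ^ 2 * c = (g * u + w ^ 2 * c) - u * g := by ring
      rw [this]; exact dvd_sub hpc2 (hpg.mul_left _)
    rcases hpZ.dvd_or_dvd hw2c with hw2 | hpc
    · have hw : (p : ℤ) ∣ w := hpZ.dvd_of_dvd_pow hw2
      have : (p : ℤ) ∣ u * d.a₁ + w * d.b₁ := dvd_add (hpa.mul_left _) (hw.mul_right _)
      rw [hbz] at this
      exact hpZ.not_dvd_one this
    · have hpfa : (p : ℤ) ∣ fa x := by rw [d.ha]; exact hpg.mul_right _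
      have hg1 : Int.gcd (Int.gcd (fa x) x.P) c = 1 := hp
      have : (p : ℤ) ∣ (Int.gcd (Int.gcd (fa x) x.P) c : ℤ) :=
        Int.dvd_coe_gcd (Int.dvd_coe_gcd hpfa hpb) hpc
      rw [hg1] at this
      exact hpZ.not_dvd_one (by exact_mod_cast this)

/-! ### The module identity `L(x)² = 2g · L(dup x)` -/

/-- **Duplication of the lattice**: `L(x)·L(x) = span{2g·Q', 2g(b' + √D)}` where
`(b', Q') = dup x` — i.e. `(2I)² = 2g·(2a'ℤ + (b' + √D)ℤ)`, `I² = (g/a')·(a'ℤ + ((b'+√D)/2)ℤ)`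
(Jozsa's Prop. 34 for `I₁ = I₂`). The four products of generators are
`4a² = g·G₁`, `2a(b + √D) = wc·G₁ + a₁·G₂`, `(b + √D)² = −uc·G₁ + b₁·G₂`, and conversely
`G₂ = u·2a(b + √D) + w·(b + √D)²`, `G₁ = α·4a² + t(b₁·2a(b + √D) − a₁(b + √D)²)` with
`αg + tc = 1`. [cite: Jozsa2003, §7.1 Prop. 34 (I₃ = I₁·I₂) and the display after it (I₂ = I·I)] -/
theorem latZ_mul_latZ {x : QuadIrr D} (h : x.IsIdealShaped) (d : DupData x) :
    latZ x * latZ x =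
      Submodule.span ℤ {(2 * dupG x * (dup x).Q : ℝ), 2 * dupG x * ((dup x).P + Real.sqrt D)} := by
  obtain ⟨hP, hQ⟩ := dup_P_Q h d
  have hs : Real.sqrt (D : ℝ) ^ 2 = D := sqrt_sq
  have hQa : (x.Q : ℝ) = 2 * (dupG x : ℝ) * d.a₁ := by
    have := Q_eq_two_mul_fa h; rw [d.ha] at this
    have h' : ((x.Q : ℤ) : ℝ) = ((2 * (dupG x * d.a₁) : ℤ) : ℝ) := congrArg _ this
    push_cast at h'; linarith
  have hb : (x.P : ℝ) = dupG x * d.b₁ := by exact_mod_cast d.hb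
  have hc : (x.P : ℝ) ^ 2 - D = 4 * (dupG x * d.a₁) * fc x := by
    have := sq_sub_eq h; rw [d.ha] at this; exact_mod_cast this
  have hbz : (dupU x : ℝ) * d.a₁ + dupW x * d.b₁ = 1 := by exact_mod_cast d.bezout₁ h
  have hαt : (d.α : ℝ) * dupG x + d.t * fc x = 1 := by exact_mod_cast d.hαt
  have hG₁ : (2 * (dupG x : ℝ) * ((dup x).Q : ℝ)) = 4 * dupG x * d.a₁ ^ 2 := by rw [hQ]; push_cast; ring
  have hG₂ : (2 * (dupG x : ℝ) * (((dup x).P : ℝ) + Real.sqrt D)) =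
      2 * dupG x * ((x.P : ℝ) - 2 * dupW x * d.a₁ * fc x + Real.sqrt D) := by rw [hP]; push_cast; ring
  -- the products of generators in terms of `G₁ = 2gQ'`, `G₂ = 2g(P' + √D)`
  have e11 : (x.Q : ℝ) * x.Q = (dupG x : ℝ) * (2 * dupG x * (dup x).Q) := by rw [hG₁, hQa]; ring
  have e12 : (x.Q : ℝ) * (x.P + Real.sqrt D) =
      ((dupW x * fc x : ℤ) : ℝ) * (2 * dupG x * (dup x).Q) + (d.a₁ : ℝ) * (2 * dupG x * ((dup x).P + Real.sqrt D)) := by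
    rw [hG₁, hG₂, hQa]; push_cast; ring
  have e22 : ((x.P : ℝ) + Real.sqrt D) * (x.P + Real.sqrt D) =
      ((-(dupU x * fc x) : ℤ) : ℝ) * (2 * dupG x * (dup x).Q) + (d.b₁ : ℝ) * (2 * dupG x * ((dup x).P + Real.sqrt D)) := by
    rw [hG₁, hG₂]; push_cast
    linear_combination hs + (2 * ((x.P : ℝ) + Real.sqrt D)) * hb + (4 * dupG x * d.a₁ * fc x) * hbz - hc
  -- and conversely
  have f2 : 2 * (dupG x : ℝ) * ((dup x).P + Real.sqrt D) =
      (dupU x : ℝ) * ((x.Q : ℝ) * (x.P + Real.sqrt D)) + (dupW x : ℝ) * (((x.P : ℝ) + Real.sqrt D) * (x.P + Real.sqrt D)) := by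
    rw [e12, e22]; push_cast
    linear_combination (-(2 * (dupG x : ℝ) * (((dup x).P : ℝ) + Real.sqrt D))) * hbz
  have f1 : 2 * (dupG x : ℝ) * (dup x).Q =
      (d.α : ℝ) * ((x.Q : ℝ) * x.Q) + ((d.t * d.b₁ : ℤ) : ℝ) * ((x.Q : ℝ) * (x.P + Real.sqrt D))
        - ((d.t * d.a₁ : ℤ) : ℝ) * (((x.P : ℝ) + Real.sqrt D) * (x.P + Real.sqrt D)) := by
    rw [e11, e12, e22]; push_cast
    linear_combination (-(2 * (dupG x : ℝ) * ((dup x).Q : ℝ))) * hαt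
      - (2 * (dupG x : ℝ) * ((dup x).Q : ℝ) * d.t * fc x) * hbz
  -- the span computation
  unfold latZ
  rw [Submodule.span_mul_span]
  apply le_antisymm
  · rw [Submodule.span_le]
    have e21 : ((x.P : ℝ) + Real.sqrt D) * x.Q =
        ((dupW x * fc x : ℤ) : ℝ) * (2 * dupG x * (dup x).Q) + (d.a₁ : ℝ) * (2 * dupG x * ((dup x).P + Real.sqrt D)) := by
      rw [mul_comm]; exact e12
    rintro r ⟨p, hp, q, hq, rfl⟩
    dsimp only
    simp only [Set.mem_insert_iff, Set.mem_singleton_iff] at hp hq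
    rw [SetLike.mem_coe, Submodule.mem_span_pair]
    rcases hp with rfl | rfl <;> rcases hq with rfl | rfl
    · exact ⟨dupG x, 0, by rw [e11]; simp [zsmul_eq_mul]⟩
    · exact ⟨dupW x * fc x, d.a₁, by rw [e12]; simp only [zsmul_eq_mul]⟩
    · exact ⟨dupW x * fc x, d.a₁, by rw [e21]; simp only [zsmul_eq_mul]⟩
    · exact ⟨-(dupU x * fc x), d.b₁, by rw [e22]; simp only [zsmul_eq_mul]⟩
  · rw [Submodule.span_le]
    have hS : ∀ p q : ℝ, p ∈ ({(x.Q : ℝ), (x.P : ℝ) + Real.sqrt D} : Set ℝ) →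
        q ∈ ({(x.Q : ℝ), (x.P : ℝ) + Real.sqrt D} : Set ℝ) →
        p * q ∈ Submodule.span ℤ (({(x.Q : ℝ), (x.P : ℝ) + Real.sqrt D} : Set ℝ) * {(x.Q : ℝ), (x.P : ℝ) + Real.sqrt D}) :=
      fun p q hp hq => Submodule.subset_span (Set.mul_mem_mul hp hq)
    have h11 := hS _ _ (Set.mem_insert _ _) (Set.mem_insert _ _)
    have h12 := hS _ _ (Set.mem_insert _ _) (Set.mem_insert_of_mem _ (Set.mem_singleton _))
    have h22 := hS _ _ (Set.mem_insert_of_mem _ (Set.mem_singleton _)) (Set.mem_insert_of_mem _ (Set.mem_singleton _))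
    rintro r hr
    simp only [Set.mem_insert_iff, Set.mem_singleton_iff] at hr
    rw [SetLike.mem_coe]
    rcases hr with rfl | rfl
    · rw [f1]
      refine Submodule.sub_mem _ (Submodule.add_mem _ ?_ ?_) ?_
      · simpa [zsmul_eq_mul] using Submodule.smul_mem _ d.α h11
      · simpa [zsmul_eq_mul] using Submodule.smul_mem _ (d.t * d.b₁) h12
      · simpa [zsmul_eq_mul] using Submodule.smul_mem _ (d.t * d.a₁) h22
    · rw [f2]
      refine Submodule.add_mem _ ?_ ?_
      · simpa [zsmul_eq_mul] using Submodule.smul_mem _ (dupU x) h12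
      · simpa [zsmul_eq_mul] using Submodule.smul_mem _ (dupW x) h22

/-- Products of elements of `L(x)` lie in `L(x)·L(x)`. [folklore] -/
theorem mul_mem_latZ_mul {x : QuadIrr D} {s t : ℝ} (hs : s ∈ latZ x) (ht : t ∈ latZ x) :
    s * t ∈ latZ x * latZ x :=
  Submodule.mul_mem_mul hs ht

end QuadIrr

end Literature.NumberTheory.QuadraticFields

end
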